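import Literature.NumberTheory.Automorphic.OrdinaryCompletedCohomologyGL
import Literature.NumberTheory.Automorphic.CompletedCohomologyActionGL
import Literature.NumberTheory.Automorphic.TameLevelScalarFactorisation
import Mathlib.LinearAlgebra.Matrix.Charpoly.Coeff
import HarnessLib

/-!
# Congruence depth of a tame level at the bad places; continuity of the diamond operators

* `exists_forall_ofLocal_mem`: an open tame level `U` contains `ι_w(K_w(ϖ_w^c))` for
  one depth `c` and all bad places `w` (`continuous_ofLocal`, `exists_localCongruenceSubgroup_subset`).
* `localScalar_mem_localCongruenceSubgroup`: the local scalar `a · 1` of a global `a ≡ 1 mod w^c` lies in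
  `K_w(ϖ_w^c)`.
* `tendsto_apply_ordDiamond`: for a CONTINUOUS point `x` of `𝕋^{S,ord}(𝒰)` and local units
  `r_B → 1` (`r_B ≡ 1 mod ϖ_v^B`), `x(⟨r_B⟩_v) → 1`: the diamond operator of a unit `≡ 1 mod ϖ_v^B`
  is the identity on every `H^i(X_{U(r)}, ℤ/p^s)` with `max r 1 ≤ B` (`diamondElement_mem_hidaLevel`,
  `heckeEnd_eq_id_of_mem`), so `⟨r_B⟩_v → 1` in the product of the discrete endomorphism rings.
[folklore]
-/

open Literature.NumberTheory.Automorphic Literature.NumberTheory.Automorphic.BigHeckeGLn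
open NumberField IsDedekindDomain Filter Topology CategoryTheory

namespace Literature.NumberTheory.Automorphic.BigHeckeGLn

noncomputable section

variable {n : ℕ} {K : Type} [Field K] [NumberField K] {p : ℕ} [Fact p.Prime] (𝒰 : TameLevel n K p)

/-! ### Congruence depth at the bad places -/

/-- **An open tame level contains the deep principal congruence subgroups at its bad places**, with
one depth `c` for all of them. [folklore] -/
theorem exists_forall_ofLocal_mem :
    ∃ c : ℕ, ∀ w ∈ 𝒰.bad, ∀ g ∈ localCongruenceSubgroup n K w c, ofLocal n K w g ∈ 𝒰.subgroup := by
  classical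
  have hw : ∀ w : HeightOneSpectrum (𝓞 K), ∃ c : ℕ, ∀ g ∈ localCongruenceSubgroup n K w c,
      ofLocal n K w g ∈ 𝒰.subgroup := fun w => by
    have hmem : (ofLocal n K w) ⁻¹' (𝒰.subgroup : Set (FiniteAdelicGL n K)) ∈
        𝓝 (1 : GL (Fin n) (w.adicCompletion K)) :=
      (continuous_ofLocal w).continuousAt.preimage_mem_nhds
        (by rw [map_one]; exact 𝒰.isOpen.mem_nhds (one_mem _))
    obtain ⟨c, hc⟩ := exists_localCongruenceSubgroup_subset n K w hmem
    exact ⟨c, fun g hg => hc hg⟩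
  choose c hc using hw
  refine ⟨𝒰.bad_finite.toFinset.sup c, fun w hwb g hg => hc w g ?_⟩
  exact localCongruenceSubgroup_antitone n K w (Finset.le_sup (𝒰.bad_finite.mem_toFinset.2 hwb)) hg

omit [Fact p.Prime] 𝒰 in
/-- **The local scalar of `a ≡ 1 (mod w^c)` lies in `K_w(ϖ_w^c)`** (`c ≥ 1`). [folklore] -/
theorem localScalar_mem_localCongruenceSubgroup (w : HeightOneSpectrum (𝓞 K)) (a : Kˣ) {c : ℕ} (hc : 1 ≤ c)
    (ha : Valued.v (algebraMap K (w.adicCompletion K) (a : K) - 1) ≤ WithZero.exp (-(c : ℤ))) :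
    localScalar (n := n) w a ∈ localCongruenceSubgroup n K w c := by
  set t : w.adicCompletion K := algebraMap K (w.adicCompletion K) (a : K) with ht
  have hlt : Valued.v (t - 1) < 1 := by
    refine ha.trans_lt ?_
    rw [← WithZero.exp_zero, WithZero.exp_lt_exp]; omega
  have ht1 : Valued.v t = 1 := by
    have h := Valued.v.map_add_eq_of_lt_left (x := (1 : w.adicCompletion K)) (y := t - 1) (by rwa [Valuation.map_one])
    rwa [Valuation.map_one, add_sub_cancel] at h
  have hinv : Valued.v t⁻¹ = 1 := by rw [map_inv₀, ht1, inv_one]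
  have hdiag : ∀ (e : (w.adicCompletion K)ˣ) (i j : Fin n), Valued.v ((e : w.adicCompletion K)) ≤ 1 →
      Valued.v ((glDiagonal n (w.adicCompletion K) (fun _ => e) : Matrix (Fin n) (Fin n) (w.adicCompletion K)) i j) ≤ 1 := by
    intro e i j he
    rw [coe_glDiagonal, Matrix.diagonal_apply]
    split_ifs
    · exact he
    · simp
  refine (mem_valuedCongruenceSubgroup_iff (m := Fin n)).2 ⟨fun i j => ?_, fun i j => ?_, fun i j => ?_⟩
  · exact hdiag _ i j ht1.le
  · rw [localScalar, ← map_inv]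
    change Valued.v ((glDiagonal n (w.adicCompletion K)
      (fun _ => (Units.map (algebraMap K (w.adicCompletion K) : K →* w.adicCompletion K) a)⁻¹) :
        Matrix (Fin n) (Fin n) (w.adicCompletion K)) i j) ≤ 1
    exact hdiag _ i j (by rw [Units.val_inv_eq_inv_val, Units.coe_map, MonoidHom.coe_coe]; exact hinv.le)
  · rw [Matrix.sub_apply, localScalar, coe_glDiagonal, Matrix.diagonal_apply, Matrix.one_apply]
    split_ifs
    · exact ha
    · simp

/-! ### Hecke operators of level elements; diamond elements deep in the tower -/

omit [Fact p.Prime] 𝒰 in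
/-- The Hecke operator of an element OF the level is the identity (`[L g L] = [L]`). [folklore] -/
theorem heckeEnd_eq_id_of_mem (k : Type) [CommRing k] {Γ 𝒢 : Type} [Group Γ] [Group 𝒢] (ι : Γ →* 𝒢)
    {L : Subgroup 𝒢} (M : Type) [AddCommGroup M] [Module k M] {g : 𝒢} (hg : g ∈ L) (i : ℕ) :
    ArithmeticQuotient.heckeEnd k L g M ι i = LinearMap.id := by
  have hconj : ∀ l ∈ L, g⁻¹ * l * g ∈ L := fun l hl => mul_mem (mul_mem (inv_mem hg) hl) hg
  have hrep : ArithmeticQuotient.heckeRepHom k L g M ι = 𝟙 _ := by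
    refine Rep.hom_ext (Representation.IntertwiningMap.ext (LinearMap.ext fun f => funext fun c => ?_))
    induction c using QuotientGroup.induction_on with
    | H y =>
      change ArithmeticQuotient.heckeFun k L g M f (y : 𝒢 ⧸ L) = f y
      rw [ArithmeticQuotient.heckeFun_apply_mk_of_conj k M hconj f y]
      congr 1
      exact QuotientGroup.eq.2 (by simpa using hg)
  unfold ArithmeticQuotient.heckeEnd ArithmeticQuotient.heckeOperator
  rw [hrep, groupCohomology.map_id]
  exact ModuleCat.hom_id

variable {𝒰}

/-- **A diamond element `⟨d⟩_v` with `d ≡ 1 (mod ϖ_v^r)` lies in the Hida level `U(r)`** (for `U`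
maximal above `p`): diagonal unit matrices congruent to `1` satisfy the Iwahori conditions. [folklore] -/
theorem diamondElement_mem_hidaLevel (h𝒰 : 𝒰.IsMaximalAbove) {v : HeightOneSpectrum (𝓞 K)}
    (hv : (p : 𝓞 K) ∈ v.asIdeal) (d : Fin n → (v.adicCompletionIntegers K)ˣ) (r : ℕ)
    (hd : ∀ j, Valued.v (((d j : v.adicCompletionIntegers K) : v.adicCompletion K) - 1) ≤ WithZero.exp (-(r : ℤ))) :
    diamondElement n K v d ∈ 𝒰.hidaLevel r := by
  have hone : ∀ j, Valued.v ((unitsToLocal n v d j : (v.adicCompletion K)ˣ) : v.adicCompletion K) = 1 :=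
    valued_unitsToLocal v d
  have hIw : ∀ (e : Fin n → (v.adicCompletion K)ˣ), (∀ j, Valued.v (e j : v.adicCompletion K) = 1) →
      (∀ j, Valued.v ((e j : v.adicCompletion K) - 1) ≤ WithZero.exp (-(r : ℤ))) →
      IwahoriCond (Fin n) (WithZero.exp (-(r : ℤ)) : WithZero (Multiplicative ℤ)) (WithZero.exp (-(max r 1 : ℕ) : ℤ))
        ((glDiagonal n (v.adicCompletion K) e : GL (Fin n) (v.adicCompletion K)) : Matrix (Fin n) (Fin n) (v.adicCompletion K)) := by
    intro e he he1
    refine ⟨fun i j => ?_, fun i j hij => ?_, fun i => ?_⟩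
    · rw [coe_glDiagonal, Matrix.diagonal_apply]
      split_ifs
      · exact (he i).le
      · simp
    · rw [coe_glDiagonal, Matrix.diagonal_apply_ne _ (ne_of_gt hij)]; simp
    · rw [coe_glDiagonal, Matrix.diagonal_apply_eq]; exact he1 i
  refine (𝒰.mem_hidaLevel_iff r _).2 ⟨?_, fun w hw => ?_⟩
  · rw [diamondElement_apply]
    exact h𝒰.ofLocal_mem v hv _ (glDiagonal_mem_valuedCongruenceSubgroup_one_of_eq_one hone)
  · by_cases hwv : w = v
    · subst hwv
      rw [diamondElement_apply, localComponent_ofLocal]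
      refine ⟨hIw _ hone hd, ?_⟩
      rw [← map_inv, ← map_inv]
      refine hIw _ (valued_unitsToLocal w d⁻¹) fun j => ?_
      have hval : ((unitsToLocal n w d⁻¹ j : (w.adicCompletion K)ˣ) : w.adicCompletion K) =
          (((unitsToLocal n w d j : (w.adicCompletion K)ˣ) : w.adicCompletion K))⁻¹ := by
        rw [map_inv, Pi.inv_apply, Units.val_inv_eq_inv_val]
      rw [hval]
      set y : w.adicCompletion K := ((unitsToLocal n w d j : (w.adicCompletion K)ˣ) : w.adicCompletion K) with hy
      have hy0 : y ≠ 0 := Units.ne_zero _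
      have hrew : y⁻¹ - 1 = y⁻¹ * (1 - y) := by field_simp
      rw [hrew, map_mul, map_inv₀, hone, inv_one, one_mul, Valuation.map_sub_swap]
      exact hd j
    · rw [diamondElement_apply, localComponent_ofLocal_of_ne hwv]
      exact one_mem _

/-! ### Continuity of the diamond operators at a continuous point -/

/-- At an index `(i, r, s)` with `d ≡ 1 (mod ϖ_v^r)`, the component of the diamond operator `⟨d⟩_v`
of `𝕋^{S,ord}(𝒰)` is `1`. [folklore] -/
theorem coe_ordDiamond_apply_eq_one (h𝒰 : 𝒰.IsMaximalAbove) {v : HeightOneSpectrum (𝓞 K)}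
    (hv : (p : 𝓞 K) ∈ v.asIdeal) (d : Fin n → (v.adicCompletionIntegers K)ˣ) (idx : TowerIndex)
    (hd : ∀ j, Valued.v (((d j : v.adicCompletionIntegers K) : v.adicCompletion K) - 1) ≤
      WithZero.exp (-(idx.2.1 : ℤ))) :
    ((𝒰.ordDiamond hv d : OrdinaryHeckeAlgebraGLn 𝒰) : 𝒰.ordEndProd ℤ) idx = 1 := by
  have hmem := diamondElement_mem_hidaLevel h𝒰 hv d idx.2.1 hd
  have h1 : 𝒰.hidaFamily ℤ (diamondElement n K v d) idx = 1 := by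
    rw [TameLevel.hidaFamily_apply]
    exact heckeEnd_eq_id_of_mem ℤ (globalEmbedding n K) (modPow ℤ (p : ℤ) idx.2.2) hmem idx.1
  change 𝒰.restrictOrd ℤ idx ⟨𝒰.hidaFamily ℤ (diamondElement n K v d) idx,
    𝒰.hidaFamily_apply_mem_hidaLevelSubring ℤ (𝒰.diamondElement_mem_hidaElements hv d) idx⟩ = 1
  have h : (⟨𝒰.hidaFamily ℤ (diamondElement n K v d) idx,
      𝒰.hidaFamily_apply_mem_hidaLevelSubring ℤ (𝒰.diamondElement_mem_hidaElements hv d) idx⟩ :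
        𝒰.hidaLevelSubring ℤ idx) = 1 := Subtype.ext h1
  rw [h, map_one]

/-- **`⟨r_B⟩_v → 1` in `𝕋^{S,ord}(𝒰)`** for local units `r_B ≡ 1 (mod ϖ_v^B)` (product of discrete
topologies: each component is eventually `1`). [folklore] -/
theorem tendsto_ordDiamond (h𝒰 : 𝒰.IsMaximalAbove) {v : HeightOneSpectrum (𝓞 K)} (hv : (p : 𝓞 K) ∈ v.asIdeal)
    (r : ℕ → Fin n → (v.adicCompletionIntegers K)ˣ)
    (hr : ∀ B j, Valued.v (((r B j : v.adicCompletionIntegers K) : v.adicCompletion K) - 1) ≤ WithZero.exp (-(B : ℤ))) :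
    Tendsto (fun B => 𝒰.ordDiamond hv (r B)) atTop (𝓝 1) := by
  rw [tendsto_subtype_rng]
  refine tendsto_pi_nhds.2 fun idx => ?_
  refine (tendsto_const_nhds (x := (1 : 𝒰.ordEndProd ℤ) idx)).congr' ?_
  filter_upwards [eventually_ge_atTop idx.2.1] with B hB
  rw [Pi.one_apply]
  refine (coe_ordDiamond_apply_eq_one h𝒰 hv (r B) idx fun j => (hr B j).trans ?_).symm
  rw [WithZero.exp_le_exp]; omega

/-- **`x(⟨r_B⟩_v) → 1` for a CONTINUOUS point `x` of `𝕋^{S,ord}(𝒰)`** and local units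
`r_B ≡ 1 (mod ϖ_v^B)`. [folklore] -/
theorem tendsto_apply_ordDiamond {A : Type*} [NonAssocSemiring A] [TopologicalSpace A]
    (x : OrdinaryHeckeAlgebraGLn 𝒰 →+* A) (hx : Continuous x) (h𝒰 : 𝒰.IsMaximalAbove)
    {v : HeightOneSpectrum (𝓞 K)} (hv : (p : 𝓞 K) ∈ v.asIdeal) (r : ℕ → Fin n → (v.adicCompletionIntegers K)ˣ)
    (hr : ∀ B j, Valued.v (((r B j : v.adicCompletionIntegers K) : v.adicCompletion K) - 1) ≤ WithZero.exp (-(B : ℤ))) :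
    Tendsto (fun B => x (𝒰.ordDiamond hv (r B))) atTop (𝓝 1) := by
  have h := (hx.tendsto 1).comp (tendsto_ordDiamond h𝒰 hv r hr)
  rwa [map_one] at h

end

end Literature.NumberTheory.Automorphic.BigHeckeGLn

/-!
## Association with a point of `𝕋^{S,ord}(𝒰)` pins `det ρ(Frob_w) = q_w · x(T_{w,2})`

For a ring homomorphism `x : 𝕋^{S,ord}(𝒰) → ℚ̄_p` (rank `2`) associated with `ρ`
(`TameLevel.IsOrdAssociated`, arithmetic Frobenius, `heckeFrobPoly 2 q a = X² − a₁ X + q a₂`):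
`det ρ(σ) = q_w · x(T_{w,2})` at every arithmetic Frobenius `σ` above a good place `w`
(`det_frob_of_isOrdAssociated`), and `T_{w,n}` is invertible in `𝕋^{S,ord}(𝒰)` with inverse the
operator of the central `t_{w,n}⁻¹` (`ordT_self_mul_ordTInv`). [folklore]
-/

open Literature.NumberTheory.Automorphic Literature.NumberTheory.Automorphic.BigHeckeGLn
open Literature.NumberTheory.GaloisRepresentations
open NumberField IsDedekindDomain Polynomial

namespace Literature.NumberTheory.Automorphic.BigHeckeGLn

noncomputable section

variable {n : ℕ} {F : Type} [Field F] [NumberField F] {p : ℕ} [Fact p.Prime] (𝒰 : TameLevel n F p)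

/-- The central Hecke element `t_{w,n}` is central in `GL_n(𝔸_F^∞)` (restated for this file's
imports). [folklore] -/
private theorem heckeElement_self_mem_center' (w : HeightOneSpectrum (𝓞 F)) :
    heckeElement n F w n ∈ Subgroup.center (FiniteAdelicGL n F) :=
  Subgroup.mem_center_iff.2 fun x => (heckeElement_self_mul_comm w x).symm

/-- **`T_{w,n} · T_{w,n}⁻¹ = 1` in `𝕋^S(𝒰; p)`** at a good place `w` (operators of the central
`t_{w,n}^{±1}`, `hidaFamily_mul_of_conj`). [folklore] -/
theorem hidaT_self_mul_hidaTInv {w : HeightOneSpectrum (𝓞 F)} (hw : w ∉ 𝒰.bad) :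
    𝒰.hidaT w n * 𝒰.hidaTInv w = 1 := by
  classical
  have hw' : 𝒰.IsHidaPlace w := Or.inl hw
  have hc : ∀ (t : FiniteAdelicGL n F), t ∈ Subgroup.center (FiniteAdelicGL n F) →
      ∀ r, ∀ x ∈ 𝒰.hidaLevel r, t⁻¹ * x * t ∈ 𝒰.hidaLevel r := fun t ht r x hx => by
    rwa [mul_assoc, Subgroup.mem_center_iff.1 ht x, inv_mul_cancel_left]
  apply Subtype.ext
  rw [Subring.coe_mul, Subring.coe_one, TameLevel.coe_hidaT 𝒰 hw', TameLevel.hidaTInv, dif_pos hw']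
  change 𝒰.hidaFamily ℤ (heckeElement n F w n) * 𝒰.hidaFamily ℤ (heckeElement n F w n)⁻¹ = 1
  rw [← 𝒰.hidaFamily_mul_of_conj ℤ (hc _ (heckeElement_self_mem_center' w))
    (hc _ (inv_mem (heckeElement_self_mem_center' w))), mul_inv_cancel, 𝒰.hidaFamily_one]

/-- **`T_{w,n}⁻¹ · T_{w,n} = 1` in `𝕋^S(𝒰; p)`** at a good place `w`. [folklore] -/
theorem hidaTInv_mul_hidaT_self {w : HeightOneSpectrum (𝓞 F)} (hw : w ∉ 𝒰.bad) :
    𝒰.hidaTInv w * 𝒰.hidaT w n = 1 := by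
  classical
  have hw' : 𝒰.IsHidaPlace w := Or.inl hw
  have hc : ∀ (t : FiniteAdelicGL n F), t ∈ Subgroup.center (FiniteAdelicGL n F) →
      ∀ r, ∀ x ∈ 𝒰.hidaLevel r, t⁻¹ * x * t ∈ 𝒰.hidaLevel r := fun t ht r x hx => by
    rwa [mul_assoc, Subgroup.mem_center_iff.1 ht x, inv_mul_cancel_left]
  apply Subtype.ext
  rw [Subring.coe_mul, Subring.coe_one, TameLevel.coe_hidaT 𝒰 hw', TameLevel.hidaTInv, dif_pos hw']
  change 𝒰.hidaFamily ℤ (heckeElement n F w n)⁻¹ * 𝒰.hidaFamily ℤ (heckeElement n F w n) = 1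
  rw [← 𝒰.hidaFamily_mul_of_conj ℤ (hc _ (inv_mem (heckeElement_self_mem_center' w)))
    (hc _ (heckeElement_self_mem_center' w)), inv_mul_cancel, 𝒰.hidaFamily_one]

/-- **`T_{w,n} · T_{w,n}⁻¹ = 1` in the ordinary Hecke algebra `𝕋^{S,ord}(𝒰)`.** [folklore] -/
theorem ordT_self_mul_ordTInv {w : HeightOneSpectrum (𝓞 F)} (hw : w ∉ 𝒰.bad) :
    𝒰.ordT w n * 𝒰.ordTInv w = 1 := by
  rw [← TameLevel.toOrd_hidaT, ← TameLevel.toOrd_hidaTInv, ← map_mul, hidaT_self_mul_hidaTInv 𝒰 hw, map_one]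

/-- **`T_{w,n}⁻¹ · T_{w,n} = 1` in `𝕋^{S,ord}(𝒰)`.** [folklore] -/
theorem ordTInv_mul_ordT_self {w : HeightOneSpectrum (𝓞 F)} (hw : w ∉ 𝒰.bad) :
    𝒰.ordTInv w * 𝒰.ordT w n = 1 := by
  rw [← TameLevel.toOrd_hidaT, ← TameLevel.toOrd_hidaTInv, ← map_mul, hidaTInv_mul_hidaT_self 𝒰 hw, map_one]

omit [Fact p.Prime] 𝒰 in
/-- The rank-two Hecke–Frobenius polynomial is `X² − a₁ X + q a₂` (unfolding `heckeFrobPoly`). [folklore] -/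
private theorem heckeFrobPoly_two' {R : Type*} [CommRing R] (q : ℕ) (a : ℕ → R) :
    heckeFrobPoly 2 q a = X ^ 2 - C (a 1) * X + C ((q : R) * a 2) := by
  have h : Finset.Icc 1 2 = {1, 2} := by decide
  rw [heckeFrobPoly, h, Finset.sum_insert (by decide), Finset.sum_singleton]
  norm_num
  abel

omit [Fact p.Prime] 𝒰 in
/-- `charpoly M = X² − a₁ X + q a₂ ⟹ det M = q a₂` (the constant coefficient). [folklore] -/
theorem det_eq_of_charpoly_eq_heckeFrobPoly {A : Type*} [CommRing A] (M : Matrix (Fin 2) (Fin 2) A) (q : ℕ)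
    (a : ℕ → A) (h : M.charpoly = heckeFrobPoly 2 q a) : M.det = (q : A) * a 2 := by
  have h0 := congrArg (fun f : A[X] => f.coeff 0) h
  simp only [heckeFrobPoly_two', coeff_add, coeff_sub, coeff_X_pow, coeff_C_mul, coeff_X_zero, coeff_C_zero,
    mul_zero, sub_zero] at h0
  rw [Matrix.det_eq_sign_charpoly_coeff, Fintype.card_fin, h0]
  norm_num

/-- **Association pins the determinant of Frobenius**: if `x : 𝕋^{S,ord}(𝒰) → ℚ̄_p` (rank `2`) is
associated with `ρ`, then `det ρ(σ) = q_w · x(T_{w,2})` for every arithmetic Frobenius `σ` above a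
good place `w ∉ S`. [folklore] -/
theorem det_frob_of_isOrdAssociated {𝒰 : TameLevel 2 F p}
    {x : OrdinaryHeckeAlgebraGLn 𝒰 →+* PadicAlgCl p} {ρ : FramedGaloisRep F (PadicAlgCl p) 2}
    (h : 𝒰.IsOrdAssociated x ρ) {w : HeightOneSpectrum (𝓞 F)} (hw : w ∉ 𝒰.bad)
    {𝔓 : Ideal (absIntegers (𝓞 F) F)} (h𝔓 : 𝔓 ∈ w.primesAbove) {σ : Field.absoluteGaloisGroup F}
    (hσ : IsArithFrobAt (𝓞 F) σ 𝔓) :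
    (ρ σ).val.det = (Ideal.absNorm w.asIdeal : PadicAlgCl p) * x (𝒰.ordT w 2) :=
  det_eq_of_charpoly_eq_heckeFrobPoly _ _ _ ((h w hw).2 𝔓 h𝔓 σ hσ)

/-- Association gives unramifiedness at the good places. [folklore] -/
theorem isUnramifiedAt_of_isOrdAssociated {𝒰 : TameLevel n F p} {A : Type*} [CommRing A] [TopologicalSpace A]
    {x : OrdinaryHeckeAlgebraGLn 𝒰 →+* A} {ρ : FramedGaloisRep F A n}
    (h : 𝒰.IsOrdAssociated x ρ) {w : HeightOneSpectrum (𝓞 F)} (hw : w ∉ 𝒰.bad) : ρ.IsUnramifiedAt w :=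
  (h w hw).1

end

end Literature.NumberTheory.Automorphic.BigHeckeGLn
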